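import Summits.QuantumFields.YangMills.Theorems.BalabanUVNodesN21ClosenessJunction
import Summits.QuantumFields.BalabanUV.T4Continuum.Support.NE7EtaBackgroundFlatStratum
import Summits.QuantumFields.BalabanUV.T4Continuum.Support.MinimalActionWitness
import HarnessLib

/-!
# YM-DAG node N21 (= NE7c), file 3′: the N16 ⊗ N21 junction FIRES — its binder list is jointly inhabited on the FLAT STRATUM
# (referee vacuity guard A1–A6 for `BalabanUVNodesN21ClosenessJunction.dev_close_of_n16`; kernel sanity, no estimate)

Track A of `YM-PLAN.md` (cell `pub-ymgap`, HUMAN RULING D-0062), node **N21**, seat `pub-ymgap-dag-n21-a` (KNIT-BY-NAME), companion of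
file 3 `BalabanUVNodesN21ClosenessJunction` (p410611).  Filed `--supports stmt-QuantumFields-19182`.

WHY.  File 3's junction `dev_close_of_n16` displays a long binder list — N16's statement of record `hcov : NE3EnergyRateWCov 4 𝒞 L N b g C
Λ₁ Λ₂′ dom` (NOT PRINTED, NOT PROVED), the class lines `512·5·8·L²b ≤ 1`, the budget `C·ρ₄ ≤ γ³`, the cube root `Λ₁ ≤ l₁³`, the fit
`γ(θ^k)² ≤ l₁N`, a datum `V ∈ dom`, a minimiser PAIR and the regularity of run B's minimiser.  A referee's vacuity audit asks whether
these are JOINTLY satisfiable (else every conclusion is ex falso).  They are, by name, on the one stratum where N16 is a tree THEOREM: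
the FLAT STRATUM `FS_N = {1^{w} : w unitary, 1^{w} N-periodic}` of Bałaban's everywhere-small-field class `sfClass 4 L N ε`
(`NE7EtaBackgroundFlatStratum.covRoot_flatStratum` = n16-a's `BalabanUVNodesN16.n16_flatStratum`), with the flat configuration as datum and
as BOTH runs' minimiser (`MinimalActionWitness.isMinimiser_sfClass_flatCfg`, `regular_flatCfg`).

WHAT IS PROVED ([folklore] bookkeeping; 0 `def`, 0 `sorry`).
* `junction_binders_inhabited` — for every `L ≥ 2`, `N ≥ 1`, `ε ≥ 0`, every `θ > 0` with `θ⁶ = L⁻¹` and EVERY level `k ≥ 1`: with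
  `𝒞 = sfClass 4 L N ε`, `dom = FS_N`, `b = g = C = Λ₁ = 0`, `Λ₂′ = γ = l₁ = 1`, `V = U_A = U_B = 1` ALL binders of `dev_close_of_n16` hold
  simultaneously (the fit because `θ < 1 ≤ N`).
* `junction_fires_flat` — hence file 3's `dev_close_of_n16` APPLIES at these data (its conclusion there is the true inequality
  `|‖1(∂p) − 1‖ − ‖1(∂p) − 1‖| ≤ C_Q θ^{13k}`; degenerate BY NECESSITY: N16 is a theorem only on the flat stratum — the content of NE3 ∕ NE7c
  lies elsewhere, and nothing here claims otherwise).
* `relWidth_letters_nonvacuous` — the rate letters of §4 of file 3 are non-degenerate: `0 < θ < 1`, `0 < C_Q∕ε` for `ε > 0` at the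
  sanity letters (`C_Q = 8√2 + 1536e⁸ > 0`); the letter `θ` itself exists for every `L ≥ 2` (`NE7EtaRatesD4.exists_sixth_root`, by name,
  not restated).

HONEST FRAMING.  Sanity only; count-neutral; NE7c and N16 NOT proved; one finite four-torus at fixed `ε` — NOT ℝ⁴, NOT OS, NOT a mass gap,
NOT Clay.
-/

set_option autoImplicit false

noncomputable section

open scoped BigOperators Matrix Matrix.Norms.L2Operator

namespace Summit.QuantumFields.YangMills.Theorems.N21ClosenessJunction

open Literature.MathematicalPhysics.QuantumFieldTheory.Balaban1983to89
open B7Prop1Explicit B7Prop2Explicit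
open T4AveragingDeficitWallBoundary (IsPeriodicCfg)
open Summit.QuantumFields.BalabanUV.T4Continuum
open MinimalActionSandwich (IsMinimiser)
open MinimalActionRate (Regular sfClass)
open MinimalActionWitness (flatCfg isMinimiser_sfClass_flatCfg regular_flatCfg)
open NE3EnergyShapes (IsUnitarySite)
open NE3EnergyWeightedCovShape (NE3EnergyRateWCov)
open NE7EtaBackgroundFlatStratum (covRoot_flatStratum flatCfg_mem_flatStratum)
open AveragingDeficitDualResidual (dualC1 dualC2)
open AveragingDeficitDerivWallProof (wallConst)

variable {n : Type*} [Fintype n] [DecidableEq n] [Nonempty n]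

/-- **THE BINDER LIST OF `dev_close_of_n16` IS JOINTLY INHABITED** (flat stratum, flat datum, flat minimiser pair; `b = g = C = Λ₁ = 0`,
`Λ₂′ = γ = l₁ = 1`): N16 holds there (`covRoot_flatStratum`), the class line and the budget are `0 ≤ 1`, the cube root is `0 ≤ 1`, the fit
is `(θ^k)² ≤ N` (`θ < 1 ≤ N`), the datum lies in the stratum, the flat configuration minimises BOTH runs and is regular. [folklore] -/
theorem junction_binders_inhabited {L N : ℕ} (hL : 2 ≤ L) (hN : 1 ≤ N) {ε θ : ℝ} (hε : 0 ≤ ε) (hθ : 0 < θ)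
    (hθ6 : θ ^ 6 = ((L : ℝ))⁻¹) {k : ℕ} (_hk : 1 ≤ k) :
    NE3EnergyRateWCov 4 (sfClass 4 L N ε) L N 0 0 0 0 1
        {v : Site 4 → Fin 4 → (Matrix n n ℂ)ˣ | IsPeriodicCfg v (N : ℤ) ∧ ∃ w : Site 4 → (Matrix n n ℂ)ˣ,
          IsUnitarySite w ∧ v = gaugeAct w flatCfg} ∧
      512 * (4 + 1) * (4 + 4) * (L : ℝ) ^ 2 * (0 : ℝ) ≤ 1 ∧
      (0 : ℝ) * (wallConst 4 L * (N : ℝ) ^ 2 * (Real.sqrt 0 * dualC2 4 L + 2 * (0 : ℝ) ^ 2 * dualC1 4 L)) ≤ (1 : ℝ) ^ 3 ∧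
      (0 : ℝ) ≤ (1 : ℝ) ^ 3 ∧
      (1 : ℝ) * (θ ^ k) ^ 2 ≤ 1 * (N : ℝ) ∧
      (flatCfg : Site 4 → Fin 4 → (Matrix n n ℂ)ˣ) ∈
        {v : Site 4 → Fin 4 → (Matrix n n ℂ)ˣ | IsPeriodicCfg v (N : ℤ) ∧ ∃ w : Site 4 → (Matrix n n ℂ)ˣ,
          IsUnitarySite w ∧ v = gaugeAct w flatCfg} ∧
      IsMinimiser 4 (sfClass 4 L N ε) L N k (flatCfg : Site 4 → Fin 4 → (Matrix n n ℂ)ˣ) flatCfg ∧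
      IsMinimiser 4 (sfClass 4 L N ε) L N (k + 1) (flatCfg : Site 4 → Fin 4 → (Matrix n n ℂ)ˣ) flatCfg ∧
      Regular 4 L N 0 0 (k + 1) (flatCfg : Site 4 → Fin 4 → (Matrix n n ℂ)ˣ) := by
  have hL1 : 1 ≤ L := by omega
  have hθ1 : θ < 1 := theta_lt_one hL hθ6
  refine ⟨covRoot_flatStratum hL1 hN hε 0 0 le_rfl le_rfl zero_le_one, by norm_num, by simp, by norm_num, ?_,
    flatCfg_mem_flatStratum N, isMinimiser_sfClass_flatCfg hL1 N hε k, isMinimiser_sfClass_flatCfg hL1 N hε (k + 1),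
    regular_flatCfg L N (k + 1) le_rfl le_rfl⟩
  have h1 : (θ ^ k) ^ 2 ≤ 1 := pow_le_one₀ (pow_nonneg hθ.le k) (pow_le_one₀ hθ.le hθ1.le)
  have hN' : (1 : ℝ) ≤ (N : ℝ) := by exact_mod_cast hN
  linarith

/-- **FILE 3's JUNCTION FIRES** at the sanity data: `dev_close_of_n16` applied BY NAME with every binder supplied by
`junction_binders_inhabited` — the two-run width display at the flat minimiser pair (both deviations vanish there; the point is that the
binder list types and is inhabited, not the number). [folklore] -/
theorem junction_fires_flat {L N : ℕ} (hL : 2 ≤ L) (hN : 1 ≤ N) {ε θ : ℝ} (hε : 0 ≤ ε) (hθ : 0 < θ)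
    (hθ6 : θ ^ 6 = ((L : ℝ))⁻¹) {k : ℕ} (hk : 1 ≤ k) (z : Site 4) (μ ν : Fin 4) :
    |‖((hol (flatCfg : Site 4 → Fin 4 → (Matrix n n ℂ)ˣ) z (plaqWord μ ν) : (Matrix n n ℂ)ˣ) : Matrix n n ℂ) - 1‖
        - ‖((hol (rescale L (bavg L (flatCfg : Site 4 → Fin 4 → (Matrix n n ℂ)ˣ))) z (plaqWord μ ν) :
            (Matrix n n ℂ)ˣ) : Matrix n n ℂ) - 1‖|
      ≤ (8 * (1 : ℝ) * Real.sqrt (2 * 1 * 1) + 1536 * (1 : ℝ) ^ 4 * (1 : ℝ) ^ 2 * Real.exp (8 * (1 : ℝ) ^ 2 * 1))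
          * θ ^ (13 * k) := by
  obtain ⟨hcov, hbs, hγ3, hΛl₁, hfit, hV, hA, hB, hreg⟩ := junction_binders_inhabited (n := n) hL hN hε hθ hθ6 hk
  exact dev_close_of_n16 hL hN hθ hθ6 le_rfl hbs le_rfl le_rfl one_pos hcov one_pos hγ3 one_pos hΛl₁ hk hfit hV hA hB hreg
    z μ ν

/-- **THE RATE LETTERS ARE NON-DEGENERATE**: at the sanity letters the (F∞) rate of file 3 §4 reads `ρ_k ≤ (C_Q∕ε)·θ^k` with
`0 < θ < 1` and `0 < C_Q∕ε` (`ε > 0`), `C_Q = 8√2 + 1536e⁸` — a genuine geometric rate, not `0 ≤ 0`. [folklore] -/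
theorem relWidth_letters_nonvacuous {L : ℕ} (hL : 2 ≤ L) {θ ε : ℝ} (hθ : 0 < θ) (hθ6 : θ ^ 6 = ((L : ℝ))⁻¹) (hε : 0 < ε) :
    0 < θ ∧ θ < 1 ∧
      0 < (8 * (1 : ℝ) * Real.sqrt (2 * 1 * 1) + 1536 * (1 : ℝ) ^ 4 * (1 : ℝ) ^ 2 * Real.exp (8 * (1 : ℝ) ^ 2 * 1)) / ε :=
  ⟨hθ, theta_lt_one hL hθ6, by positivity⟩

end Summit.QuantumFields.YangMills.Theorems.N21ClosenessJunction

end
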